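import Summits.Ventures.PercRepro.Night2RigidIneq

/-!
# PercRepro — the rigid cell: from the target sum to the inequality `(8′)` (night-2, gen 18)

The per-loss condition of the rigid cell (`proofs/NIGHT-2-g18.md` §7) reduces, through
`lossIncome_ge_of_bounds`, to the explicit sum

  `rigidSum n q = Σ_{j=1}^{n−3} C(n−3, j) · c_j / (3 λ C(j+3, 3)) ≥ 1`,   `c_j = c′` for `j ≤ n − 5`, `c″` else,

with `λ = (2q²+q−4)/(3q(q+1)²)`, `c′ = (3q+4)/(q(q+1)²)`, `c″ = (q²+q−1)/(q+1)²`.  The binomial identity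
`C(n−3, j)/C(j+3, 3) = 6 C(n, j+3)/(n(n−1)(n−2))` and `Σ_{i=4}^{n−2} C(n, i) = A₃(n)` turn it into
`λ n(n−1)(n−2) ≤ 2 (c′ A₃(n) + c″ (n+1))`, which is `rigid_ineq` (`Night2RigidIneq`).
**`one_le_rigidSum`** for every `n ≥ 5`, `q ≥ 4`.
-/

namespace PercRepro.Shadow.Rigid

/-- `λ = (2q²+q−4)/(3q(q+1)²)` as a closed form. -/
def lamRig (q : ℕ) : ℚ := (2 * (q : ℚ) ^ 2 + (q : ℚ) - 4) / (3 * (q : ℚ) * ((q : ℚ) + 1) ^ 2)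

/-- `c′ = (3q+4)/(q(q+1)²)`. -/
def cp (q : ℕ) : ℚ := (3 * (q : ℚ) + 4) / ((q : ℚ) * ((q : ℚ) + 1) ^ 2)

/-- `c″ = (q²+q−1)/(q+1)²`. -/
def cpp (q : ℕ) : ℚ := ((q : ℚ) ^ 2 + (q : ℚ) - 1) / ((q : ℚ) + 1) ^ 2

/-- The coefficient of the target of size `j + 3` off the coloops. -/
def cj (n q j : ℕ) : ℚ := if j + 5 ≤ n then cp q else cpp q

/-- The target sum of the rigid cell. -/
def rigidSum (n q : ℕ) : ℚ :=
  ∑ j ∈ Finset.Icc 1 (n - 3), ((n - 3).choose j : ℚ) * (cj n q j / (3 * lamRig q * ((j + 3).choose 3 : ℚ)))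

/-- `2 · C(n, 2) = n(n−1)`. -/
theorem rigid_choose_two_mul (n : ℕ) : (n.choose 2 : ℚ) * 2 = (n : ℚ) * ((n : ℚ) - 1) := by
  induction n with
  | zero => simp
  | succ m ih =>
    rw [Nat.choose_succ_succ, Nat.choose_one_right]
    push_cast
    linear_combination ih

/-- `6 · C(n, 3) = n(n−1)(n−2)`. -/
theorem rigid_choose_three_mul (n : ℕ) : (n.choose 3 : ℚ) * 6 = (n : ℚ) * ((n : ℚ) - 1) * ((n : ℚ) - 2) := by
  induction n with
  | zero => simp
  | succ m ih =>
    rw [Nat.choose_succ_succ]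
    push_cast
    have h2 := rigid_choose_two_mul m
    linear_combination ih + 3 * h2

/-- `C(j+3, 3) > 0`. -/
theorem choose_succ_three_pos (j : ℕ) : (0 : ℚ) < ((j + 3).choose 3 : ℚ) := by
  exact_mod_cast Nat.choose_pos (by omega)

/-- The binomial identity `C(n−3, j) · C(n, 3) = C(n, j+3) · C(j+3, 3)` for `j ≤ n − 3`. -/
theorem choose_sub_three_mul {n j : ℕ} (_hj : j ≤ n - 3) (_hn : 3 ≤ n) :
    ((n - 3).choose j : ℚ) * (n.choose 3 : ℚ) = (n.choose (j + 3) : ℚ) * ((j + 3).choose 3 : ℚ) := by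
  have h := Nat.choose_mul (n := n) (k := j + 3) (s := 3) (by omega)
  rw [show j + 3 - 3 = j by omega] at h
  have h' : (n - 3).choose j * n.choose 3 = n.choose (j + 3) * (j + 3).choose 3 := by
    rw [mul_comm]; exact h.symm
  exact_mod_cast h'

/-- `C(n−3, j)/C(j+3, 3) = 6 C(n, j+3)/(n(n−1)(n−2))` for `1 ≤ j ≤ n − 3`, `n ≥ 3`. -/
theorem choose_div_eq {n j : ℕ} (hj : j ≤ n - 3) (hn : 3 ≤ n) :
    ((n - 3).choose j : ℚ) / ((j + 3).choose 3 : ℚ) = 6 * (n.choose (j + 3) : ℚ) / rigidN n := by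
  have hN : rigidN n = (n.choose 3 : ℚ) * 6 := by unfold rigidN; rw [rigid_choose_three_mul]
  have h3 : (0 : ℚ) < (n.choose 3 : ℚ) := by exact_mod_cast Nat.choose_pos hn
  have hj3 := choose_succ_three_pos j
  rw [hN, div_eq_div_iff hj3.ne' (by positivity)]
  have := choose_sub_three_mul hj hn
  linear_combination 6 * this

/-- `Σ_{i=4}^{n−2} C(n, i) = A₃(n)` for `n ≥ 5` (as rationals). -/
theorem sum_choose_middle {n : ℕ} (hn : 5 ≤ n) :
    ∑ i ∈ Finset.Ico 4 (n - 1), (n.choose i : ℚ) = rigidA n := by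
  have htot : ∑ i ∈ Finset.range (n + 1), (n.choose i : ℚ) = (2 : ℚ) ^ n := by
    exact_mod_cast Nat.sum_range_choose n
  rw [Finset.range_eq_Ico] at htot
  rw [← Finset.sum_Ico_consecutive _ (by omega : 0 ≤ 4) (by omega : 4 ≤ n + 1),
    ← Finset.sum_Ico_consecutive _ (by omega : 4 ≤ n - 1) (by omega : n - 1 ≤ n + 1)] at htot
  have hlow : ∑ i ∈ Finset.Ico 0 4, (n.choose i : ℚ) =
      1 + (n : ℚ) + (n.choose 2 : ℚ) + (n.choose 3 : ℚ) := by
    rw [← Finset.range_eq_Ico]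
    simp only [Finset.sum_range_succ, Finset.sum_range_zero, Nat.choose_zero_right, Nat.choose_one_right]
    push_cast; ring
  have hhigh : ∑ i ∈ Finset.Ico (n - 1) (n + 1), (n.choose i : ℚ) = (n : ℚ) + 1 := by
    have e : Finset.Ico (n - 1) (n + 1) = {n - 1, n} := by
      ext i; simp only [Finset.mem_Ico, Finset.mem_insert, Finset.mem_singleton]; omega
    rw [e, Finset.sum_pair (by omega), Nat.choose_self]
    have : n.choose (n - 1) = n := by
      rw [Nat.choose_symm (by omega : 1 ≤ n), Nat.choose_one_right]
    rw [this]; push_cast; ring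
  rw [hlow, hhigh] at htot
  have h2 := rigid_choose_two_mul n
  have h3 := rigid_choose_three_mul n
  unfold rigidA
  linear_combination htot - h2 / 2 - h3 / 6

/-- The target sum in closed form: `rigidSum = 2 (c′ A₃ + c″ (n+1)) / (λ N)`. -/
theorem rigidSum_eq {n q : ℕ} (hn : 5 ≤ n) (hq : 4 ≤ q) :
    rigidSum n q = 2 * (cp q * rigidA n + cpp q * ((n : ℚ) + 1)) / (lamRig q * rigidN n) := by
  have hqq : (4 : ℚ) ≤ (q : ℚ) := by exact_mod_cast hq
  have hlam : 0 < lamRig q := by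
    unfold lamRig; apply div_pos _ (by positivity); nlinarith
  have hN : 0 < rigidN n := by
    unfold rigidN
    have : (5 : ℚ) ≤ (n : ℚ) := by exact_mod_cast hn
    have h1 : (0 : ℚ) < (n : ℚ) - 1 := by linarith
    have h2 : (0 : ℚ) < (n : ℚ) - 2 := by linarith
    positivity
  unfold rigidSum
  -- rewrite every term through the binomial identity
  have hterm : ∀ j ∈ Finset.Icc 1 (n - 3),
      ((n - 3).choose j : ℚ) * (cj n q j / (3 * lamRig q * ((j + 3).choose 3 : ℚ))) =
      (2 / (lamRig q * rigidN n)) * (cj n q j * (n.choose (j + 3) : ℚ)) := by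
    intro j hj
    rw [Finset.mem_Icc] at hj
    have h := choose_div_eq hj.2 (by omega)
    rw [show ((n - 3).choose j : ℚ) * (cj n q j / (3 * lamRig q * ((j + 3).choose 3 : ℚ))) =
        (cj n q j / (3 * lamRig q)) * (((n - 3).choose j : ℚ) / ((j + 3).choose 3 : ℚ)) by ring, h]
    ring
  rw [Finset.sum_congr rfl hterm, ← Finset.mul_sum]
  -- split the sum at j = n − 5
  have hsplit : ∑ j ∈ Finset.Icc 1 (n - 3), cj n q j * (n.choose (j + 3) : ℚ) =
      cp q * rigidA n + cpp q * ((n : ℚ) + 1) := by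
    have hIcc : Finset.Icc 1 (n - 3) = Finset.Ico 1 (n - 2) := by
      ext j; simp only [Finset.mem_Icc, Finset.mem_Ico]; omega
    rw [hIcc, ← Finset.sum_Ico_consecutive _ (by omega : 1 ≤ n - 4) (by omega : n - 4 ≤ n - 2)]
    have hA : ∑ j ∈ Finset.Ico 1 (n - 4), cj n q j * (n.choose (j + 3) : ℚ) = cp q * rigidA n := by
      rw [← sum_choose_middle hn, Finset.mul_sum]
      rw [Finset.sum_Ico_eq_sum_range, Finset.sum_Ico_eq_sum_range]
      rw [show n - 1 - 4 = n - 4 - 1 by omega]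
      apply Finset.sum_congr rfl
      intro k hk
      rw [Finset.mem_range] at hk
      unfold cj
      rw [if_pos (by omega), show 4 + k = 1 + k + 3 by ring]
    have hB : ∑ j ∈ Finset.Ico (n - 4) (n - 2), cj n q j * (n.choose (j + 3) : ℚ) = cpp q * ((n : ℚ) + 1) := by
      have e : Finset.Ico (n - 4) (n - 2) = {n - 4, n - 3} := by
        ext j; simp only [Finset.mem_Ico, Finset.mem_insert, Finset.mem_singleton]; omega
      rw [e, Finset.sum_pair (by omega)]
      unfold cj
      rw [if_neg (by omega), if_neg (by omega), show n - 4 + 3 = n - 1 by omega, show n - 3 + 3 = n by omega,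
        Nat.choose_self]
      have : n.choose (n - 1) = n := by
        rw [Nat.choose_symm (by omega : 1 ≤ n), Nat.choose_one_right]
      rw [this]; push_cast; ring
    rw [hA, hB]
  rw [hsplit]
  ring

/-- **The target sum is at least `1`** for every `n ≥ 5`, `q ≥ 4` — the inequality `(8′)` in its sum form. -/
theorem one_le_rigidSum {n q : ℕ} (hn : 5 ≤ n) (hq : 4 ≤ q) : 1 ≤ rigidSum n q := by
  rw [rigidSum_eq hn hq]
  have hqq : (4 : ℚ) ≤ (q : ℚ) := by exact_mod_cast hq
  have hlam : 0 < lamRig q := by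
    unfold lamRig; apply div_pos _ (by positivity); nlinarith
  have hN : 0 < rigidN n := by
    unfold rigidN
    have : (5 : ℚ) ≤ (n : ℚ) := by exact_mod_cast hn
    have h1 : (0 : ℚ) < (n : ℚ) - 1 := by linarith
    have h2 : (0 : ℚ) < (n : ℚ) - 2 := by linarith
    positivity
  rw [le_div_iff₀ (mul_pos hlam hN)]
  have hR := rigid_ineq hn hq
  unfold lamRig cp cpp
  have hq0 : (q : ℚ) ≠ 0 := by positivity
  have hq1 : (q : ℚ) + 1 ≠ 0 := by positivity
  -- multiply out: λ N ≤ 2 (c′ A₃ + c″ (n+1))  ⟺  N (2q²+q−4) ≤ 6 ((3q+4) A₃ + q (q²+q−1)(n+1))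
  have key : (2 * (q : ℚ) ^ 2 + (q : ℚ) - 4) / (3 * (q : ℚ) * ((q : ℚ) + 1) ^ 2) * rigidN n ≤
      2 * ((3 * (q : ℚ) + 4) / ((q : ℚ) * ((q : ℚ) + 1) ^ 2) * rigidA n +
        ((q : ℚ) ^ 2 + (q : ℚ) - 1) / ((q : ℚ) + 1) ^ 2 * ((n : ℚ) + 1)) := by
    rw [div_mul_eq_mul_div, div_le_iff₀ (by positivity)]
    have e : 2 * ((3 * (q : ℚ) + 4) / ((q : ℚ) * ((q : ℚ) + 1) ^ 2) * rigidA n +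
        ((q : ℚ) ^ 2 + (q : ℚ) - 1) / ((q : ℚ) + 1) ^ 2 * ((n : ℚ) + 1)) * (3 * (q : ℚ) * ((q : ℚ) + 1) ^ 2) =
        6 * ((3 * (q : ℚ) + 4) * rigidA n + (q : ℚ) * ((q : ℚ) ^ 2 + (q : ℚ) - 1) * ((n : ℚ) + 1)) := by
      field_simp
      ring
    rw [e]
    linarith [hR]
  linarith [key]

end PercRepro.Shadow.Rigid
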